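import Literature.NumberTheory.ComplexMultiplication.PairFlipSexticReflexSlotCube
import Literature.NumberTheory.ComplexMultiplication.ReflexSlotRankCollapse
import HarnessLib

/-!
# The rank of a pair-flip CM type with three conjugate pairs against a type of its REFLEX slot, I:
# ADDITIVITY off the two Hamming balls

COR-CM (cell `pub-hodgecm2`, binder seat `b16` gen 45, count-neutral claim REFLEX-OCTIC-34, file F4a); theorems only, no
definition, no named fact, no `sorry`.  Two-slot family `Σ` on `E_{i₀} ⊔ E_{i₁}` in the abstract setting of
`Literature/NumberTheory/ComplexMultiplication/CMTypeRankFamilies` (`U(·) = antiSpan`, `rank = dim U + 1`), where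

* the slot `Z = E_{i₀}` carries the type `Φ₀ = Φ_{i₀} = {x₁, x₂, x₃}` and PAIR FLIPS `φ₁, φ₂, φ₃` and `G` is transitive
  on it (a sextic CM field `K_T` with Galois closure of degree `24`/`48`: every type is nondegenerate, `U(Φ₀) = Anti(Z)`
  is irreducible — `CMTypeRankIrreducibleSlot`);
* the slot `Y = E_{i₁}` is the REFLEX SLOT of `Φ₀` (`ReflexSlotIncidence`, `PairFlipSexticReflexSlotCube`: `T : Y → Set Z`,
  `T(y₀) = Φ₀`; the embeddings of the octic reflex field `K* ≅ K_F`), with an arbitrary CM type `Ψ = Φ_{i₁}`.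

Write `u = u_1(Ψ)` (`+1` on `Ψ`, `−1` off `Ψ`) and, for `x ∈ Φ₀`, `S_x = Σ_{y : x ∈ T y} u(y)` — the FACE SUMS of `u`
(`S_x = 2·#{ψ ∈ Ψ : x ∈ Φ_ψ} − 4`).

> **Theorem** (`forall_map_slotExt_le_of_faceSums`, `typeRank_sigmaType_eq_add_of_faceSums`).  Unless
> `S_{x₁} = S_{x₂} = S_{x₃} ≠ 0`, the rank is ADDITIVE: `U(Σ) = U(Φ₀) ⊕ U(Ψ)`, `rank(Σ) = rank(Ψ) + |Z|/2`
> (`Hg(T × F) = Hg(T) × Hg(F)`), and `Σ` is nondegenerate iff `Ψ` is (`typeRank_sigmaType_eq_iff_of_faceSums`).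

The complementary COLLAPSE `rank(Σ) = rank(Ψ)` when `S_{x₁} = S_{x₂} = S_{x₃} ≠ 0`, and the identification of that case
with the two HAMMING BALLS `{y₀, φ₁y₀, φ₂y₀, φ₃y₀}`, `{ρy₀, ρφ₁y₀, ρφ₂y₀, ρφ₃y₀}`, are in the companion
`PairFlipSexticReflexSlotBalls`.

PROOF: in `U(Σ) = span{w_g = (u_g(Φ₀) ; u_g(Ψ))}` the combination
`½(w_1 − w_{φ₁}) − ¼(w_1 − w_{φ₁} − w_{φ₂} + w_{φ₁φ₂})` is `(δ_{x₁} − δ_{ρx₁} ; ¼ S_{x₁}·sgn_{x₁})`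
(`slotExt_single_add_smul_mem_antiSpan`; the `Z`-part by the pair-flip formula `a − a∘φ₁ = 2(δ_{x₁} − δ_{ρx₁})`, the
`Y`-part by the cube identity `u − u∘φ₁ + u∘φ₂ − u∘φ₁φ₂ = S_{x₁}·sgn_{x₁}` of `PairFlipSexticReflexSlotCube`).  Transporting
by `g` with `g x₂ = x₁` gives `(δ_{x₂} − δ_{ρx₂} ; ¼ S_{x₁}·sgn_{x₂}) ∈ U(Σ)`, and comparing with the same element for
`x₂` gives `(S_{x₂} − S_{x₁})·(δ_{x₂} − δ_{ρx₂} ; 0) ∈ U(Σ)`; so unless the three face sums agree (or if they all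
vanish) `U(Σ)` contains a non-zero vector supported on `Z`, hence all of `Anti(Z) ⊕ 0` (pair-flip irreducibility), hence
`0 ⊕ U(Ψ)`.

## References

* [Dodson1984] B. Dodson, *The structure of Galois groups of CM-fields*, Trans. AMS 283 (1984), §3.3.2 (Theorem: the
  simple CM fourfolds with group `ℤ₂ × 𝔖₄` that are degenerate are the reflexes of sextic types), Prop. 5.2.2, §5.1.2.
* [Gordon1999HodgeAVSurvey] B. B. Gordon, *A survey of the Hodge conjecture for abelian varieties*, §3 Theorem
  (proof), 7.5–7.7.
* [MoonenZarhin1999LowDim] B. Moonen, Yu. Zarhin, *Hodge classes on abelian varieties of low dimension*, Math. Ann.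
  315 (1999) (the mechanism `Hg(X₁ × X₂) ⊊ Hg(X₁) × Hg(X₂)`).

Provenance: Literature home (namespace `Literature.NumberTheory.ComplexMultiplication`) of the Summits-side `CorCM/PairFlipSexticReflexSlotRank` (cell `pub-hodgecm2`, COR-CM; all its imports are `Literature/`, Mathlib and the already re-homed `PairFlipSexticReflexSlotCube`, `ReflexSlotRankCollapse`), which `Literature/` may not import; theorems only, no named fact, no definition. Nothing here bears on `HC_CM`. Lane `lit-hodgefound` (Layer A3: CM types, their Kubota ranks and Galois combinatorics), seat p20.
-/

set_option autoImplicit false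

noncomputable section

open scoped BigOperators Classical

namespace Literature.NumberTheory.ComplexMultiplication

open Literature.NumberTheory.ComplexMultiplication.ReflexSlotRank

namespace ReflexSlot

open Literature.NumberTheory.ComplexMultiplication

variable {G : Type*} [Group G] {I : Type*} {E : I → Type*} [∀ i, MulAction G (E i)]
  {ρ : G} {Φ : ∀ i, Set (E i)} {i₀ i₁ : I} {T : E i₁ → Set (E i₀)} {y₀ : E i₁} {x₁ x₂ x₃ : E i₀} {φ₁ φ₂ φ₃ : G}

/-! ### §1 The explicit element of `U(Σ)` -/

/-- **Two pair flips at the same point act alike** on a slot carrying a CM type for `ρ` (both exchange `x, ρx` and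
fix the rest). [cite: Dodson1984, §5.1] -/
theorem pairFlip_smul_eq_pairFlip_smul {X : Type*} [MulAction G X] {Ψ : Set X} (hΨ : IsCMTypeWith ρ Ψ) {σ φ : G}
    {x : X} (hσ : σ • x = ρ • x ∧ ∀ w : X, w ≠ x → w ≠ ρ • x → σ • w = w)
    (hφ : φ • x = ρ • x ∧ ∀ w : X, w ≠ x → w ≠ ρ • x → φ • w = w) (z : X) : σ • z = φ • z := by
  by_cases hz : z = x
  · rw [hz, hσ.1, hφ.1]
  · by_cases hz' : z = ρ • x
    · rw [hz', hΨ.comm σ x, hσ.1, hΨ.comm φ x, hφ.1]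
    · rw [hσ.2 z hz hz', hφ.2 z hz hz']

/-- The action on `⊔_i E_i` commutes with slot extension: `(ext_i f) ∘ g = ext_i (f ∘ g)`. [cite: Gordon1999HodgeAVSurvey, §3 Theorem (proof)] -/
theorem comp_smul_slotExt (i : I) (f : E i → ℚ) (g : G) :
    (fun w : (Σ k, E k) => slotExt i f (g • w)) = slotExt i (fun z => f (g • z)) := by
  funext w
  obtain ⟨k, s⟩ := w
  rw [Sigma.smul_mk]
  by_cases hk : k = i
  · subst hk; simp only [slotExt_apply_same]
  · simp only [slotExt_apply_of_ne hk]

/-- The action on `⊔_i E_i` commutes with slot extension: `(ext_{i₀} f + c·ext_{i₁} f') ∘ g =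
ext_{i₀}(f ∘ g) + c·ext_{i₁}(f' ∘ g)`. [cite: Gordon1999HodgeAVSurvey, §3 Theorem (proof)] -/
theorem comp_smul_slotExt_add (f : E i₀ → ℚ) (f' : E i₁ → ℚ) (c : ℚ) (g : G) :
    (fun w : (Σ k, E k) => (slotExt i₀ f + c • slotExt i₁ f') (g • w)) =
      slotExt i₀ (fun z => f (g • z)) + c • slotExt i₁ (fun y => f' (g • y)) := by
  funext w
  obtain ⟨k, s⟩ := w
  rw [Sigma.smul_mk]
  simp only [Pi.add_apply, Pi.smul_apply, smul_eq_mul]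
  by_cases hk₀ : k = i₀
  · subst hk₀
    by_cases hk₁ : k = i₁
    · subst hk₁; simp only [slotExt_apply_same]
    · simp only [slotExt_apply_same, slotExt_apply_of_ne hk₁]
  · by_cases hk₁ : k = i₁
    · subst hk₁; simp only [slotExt_apply_same, slotExt_apply_of_ne hk₀]
    · simp only [slotExt_apply_of_ne hk₀, slotExt_apply_of_ne hk₁]

variable [∀ i, Fintype (E i)]

/-- **The explicit element `(δ_{x₁} − δ_{ρx₁} ; ¼ S_{x₁}·sgn_{x₁}) ∈ U(Σ)`** — it is
`½(w_1 − w_{φ₁}) − ¼(w_1 − w_{φ₁} − w_{φ₂} + w_{φ₁φ₂})`. [cite: Gordon1999HodgeAVSurvey, §3 Theorem (proof)]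
[cite: Dodson1984, §5.1.2] -/
theorem slotExt_single_add_smul_mem_antiSpan (h : ∀ i, IsCMTypeWith ρ (Φ i)) (h01 : i₀ ≠ i₁)
    (hI : ∀ k, k = i₀ ∨ k = i₁)
    (hT : ∀ (g : G) (y : E i₁) (x : E i₀), x ∈ T (g • y) ↔ g⁻¹ • x ∈ T y) (hTi : Function.Injective T)
    (hT₀ : T y₀ = Φ i₀) (hY : ∀ y : E i₁, ∃ g : G, g • y₀ = y) (hx : Φ i₀ = {x₁, x₂, x₃}) (h12 : x₁ ≠ x₂)
    (h13 : x₁ ≠ x₃) (h23 : x₂ ≠ x₃)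
    (hφ₁ : φ₁ • x₁ = ρ • x₁ ∧ ∀ z : E i₀, z ≠ x₁ → z ≠ ρ • x₁ → φ₁ • z = z)
    (hφ₂ : φ₂ • x₂ = ρ • x₂ ∧ ∀ z : E i₀, z ≠ x₂ → z ≠ ρ • x₂ → φ₂ • z = z)
    (hφ₃ : φ₃ • x₃ = ρ • x₃ ∧ ∀ z : E i₀, z ≠ x₃ → z ≠ ρ • x₃ → φ₃ • z = z) :
    slotExt i₀ (Pi.single x₁ (1 : ℚ) - Pi.single (ρ • x₁) 1) +
        ((∑ y ∈ Finset.univ.filter (fun y => x₁ ∈ T y), antiVec (Φ i₁) (1 : G) y) / 4) •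
          slotExt i₁ (fun y => if x₁ ∈ T y then (1 : ℚ) else -1) ∈ antiSpan G (sigmaType Φ) := by
  obtain ⟨m₁, m₂, m₃⟩ := mem_of_eq_triple hx
  set w : G → (Σ k, E k) → ℚ := fun g => antiVec (sigmaType Φ) g with hw
  have hwmem : ∀ g, w g ∈ antiSpan G (sigmaType Φ) := fun g => Submodule.subset_span ⟨g, rfl⟩
  -- the pair-flip formula on `Z`
  set a : E i₀ → ℚ := antiVec (Φ i₀) (1 : G) with ha
  have ha_anti : a ∈ antiWeights (E := E i₀) ρ := antiVec_mem_antiWeights (h i₀) 1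
  have hax₁ : a x₁ = 1 := by
    rw [ha, antiVec, translateInd_of_mem (show (1 : G) • x₁ ∈ Φ i₀ by rwa [one_smul])]; norm_num
  have hflip : ∀ z, a z - a (φ₁ • z) = 2 * (Pi.single x₁ (1 : ℚ) - Pi.single (ρ • x₁) 1 : E i₀ → ℚ) z := by
    intro z
    have h1 := congrFun (sub_comp_pairFlip_eq (h i₀).invol (h i₀).comm (h i₀).rho_smul_ne ha_anti hφ₁.1 hφ₁.2) z
    simp only [Pi.sub_apply, Pi.smul_apply, smul_eq_mul, hax₁, mul_one] at h1
    rw [Pi.sub_apply]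
    linarith
  have hfix₂ : φ₂ • x₁ = x₁ := (pairFlip_smul_eq_of_mem (h i₀) m₂ m₁ h12 hφ₂.2).1
  have hfix₂' : φ₂ • ρ • x₁ = ρ • x₁ := (pairFlip_smul_eq_of_mem (h i₀) m₂ m₁ h12 hφ₂.2).2
  have he₁φ₂ : ∀ z, (Pi.single x₁ (1 : ℚ) - Pi.single (ρ • x₁) 1 : E i₀ → ℚ) (φ₂ • z) =
      (Pi.single x₁ (1 : ℚ) - Pi.single (ρ • x₁) 1 : E i₀ → ℚ) z := by
    intro z
    have h1 := congrFun (single_sub_single_comp_smul (ρ := ρ) (h i₀).comm x₁ φ₂) z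
    have h2 : φ₂⁻¹ • x₁ = x₁ := by rw [inv_smul_eq_iff, hfix₂]
    simp only [h2] at h1
    exact h1
  -- the cube identity on `Y`
  have hu : ∀ y, antiVec (Φ i₁) (1 : G) (ρ • y) = -antiVec (Φ i₁) (1 : G) y := fun y =>
    (mem_antiWeights_iff'.1 (antiVec_mem_antiWeights (h i₁) 1)) y
  have hcube := sub_add_sub_eq_faceSum_mul_sign (h i₀) hT hTi hT₀ hY hx h12 h13 h23 hφ₁ hφ₂ hφ₃ hu
  -- the combination, slot by slot
  set L : (Σ k, E k) → ℚ := slotExt i₀ (Pi.single x₁ (1 : ℚ) - Pi.single (ρ • x₁) 1) +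
      ((∑ y ∈ Finset.univ.filter (fun y => x₁ ∈ T y), antiVec (Φ i₁) (1 : G) y) / 4) •
        slotExt i₁ (fun y => if x₁ ∈ T y then (1 : ℚ) else -1) with hL
  set R : (Σ k, E k) → ℚ := (1 / 2 : ℚ) • (w 1 - w φ₁) - (1 / 4 : ℚ) • (w 1 - w φ₁ - w φ₂ + w (φ₁ * φ₂)) with hR
  have hZ : ∀ s : E i₀, L ⟨i₀, s⟩ = R ⟨i₀, s⟩ := by
    intro s
    simp only [hL, hR, hw, Pi.add_apply, Pi.sub_apply, Pi.smul_apply, smul_eq_mul, antiVec_sigmaType,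
      slotExt_apply_same, slotExt_apply_of_ne h01]
    have e1 : antiVec (Φ i₀) φ₁ s = a (φ₁ • s) := by rw [ha, antiVec_apply_smul, one_mul]
    have e2 : antiVec (Φ i₀) φ₂ s = a (φ₂ • s) := by rw [ha, antiVec_apply_smul, one_mul]
    have e3 : antiVec (Φ i₀) (φ₁ * φ₂) s = a (φ₁ • φ₂ • s) := by
      rw [ha, antiVec_apply_smul, one_mul, antiVec_apply_smul]
    rw [e1, e2, e3, ← ha]
    have h1 := hflip s
    have h2 := hflip (φ₂ • s)
    rw [he₁φ₂] at h2
    simp only [Pi.sub_apply] at h1 h2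
    linarith
  have hY' : ∀ s : E i₁, L ⟨i₁, s⟩ = R ⟨i₁, s⟩ := by
    intro s
    simp only [hL, hR, hw, Pi.add_apply, Pi.sub_apply, Pi.smul_apply, smul_eq_mul, antiVec_sigmaType,
      slotExt_apply_same, slotExt_apply_of_ne (Ne.symm h01)]
    have e1 : antiVec (Φ i₁) φ₁ s = antiVec (Φ i₁) (1 : G) (φ₁ • s) := by rw [antiVec_apply_smul, one_mul]
    have e2 : antiVec (Φ i₁) φ₂ s = antiVec (Φ i₁) (1 : G) (φ₂ • s) := by rw [antiVec_apply_smul, one_mul]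
    have e3 : antiVec (Φ i₁) (φ₁ * φ₂) s = antiVec (Φ i₁) (1 : G) ((φ₁ * φ₂) • s) := by
      rw [antiVec_apply_smul, one_mul]
    rw [e1, e2, e3]
    have h1 := hcube s
    linarith
  have heq : L = R := by
    funext p
    obtain ⟨k, s⟩ := p
    rcases hI k with rfl | rfl
    · exact hZ s
    · exact hY' s
  change L ∈ antiSpan G (sigmaType Φ)
  rw [heq, hR]
  exact Submodule.sub_mem _ (Submodule.smul_mem _ _ (Submodule.sub_mem _ (hwmem 1) (hwmem φ₁)))
    (Submodule.smul_mem _ _ (Submodule.add_mem _ (Submodule.sub_mem _ (Submodule.sub_mem _ (hwmem 1) (hwmem φ₁))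
      (hwmem φ₂)) (hwmem _)))

omit [∀ i, Fintype (E i)] in
/-- **Transport of the explicit element**: from `(δ_x − δ_{ρx} ; c·sgn_x) ∈ U(Σ)` and `g x' = x` follows
`(δ_{x'} − δ_{ρx'} ; c·sgn_{x'}) ∈ U(Σ)` (`U(Σ)` is a `G`-module). [cite: Gordon1999HodgeAVSurvey, §3 Theorem (proof)] -/
theorem slotExt_single_add_smul_mem_antiSpan_of_smul_eq (h : ∀ i, IsCMTypeWith ρ (Φ i))
    (hT : ∀ (g : G) (y : E i₁) (x : E i₀), x ∈ T (g • y) ↔ g⁻¹ • x ∈ T y) {x x' : E i₀} {c : ℚ}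
    (hmem : slotExt i₀ (Pi.single x (1 : ℚ) - Pi.single (ρ • x) 1) +
      c • slotExt i₁ (fun y => if x ∈ T y then (1 : ℚ) else -1) ∈ antiSpan G (sigmaType Φ))
    {g : G} (hg : g • x' = x) :
    slotExt i₀ (Pi.single x' (1 : ℚ) - Pi.single (ρ • x') 1) +
      c • slotExt i₁ (fun y => if x' ∈ T y then (1 : ℚ) else -1) ∈ antiSpan G (sigmaType Φ) := by
  have h1 := comp_smul_mem_antiSpan hmem g
  rw [comp_smul_slotExt_add, single_sub_single_comp_smul (h i₀).comm x g] at h1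
  have hg' : g⁻¹ • x = x' := by rw [inv_smul_eq_iff, hg]
  have h2 : (fun y => if x ∈ T (g • y) then (1 : ℚ) else -1) = fun y => if x' ∈ T y then (1 : ℚ) else -1 := by
    funext y; rw [hT, hg']
  rwa [hg', h2] at h1

omit [∀ i, Fintype (E i)] in
/-- `δ_x − δ_{ρx} ≠ 0`. [cite: Gordon1999HodgeAVSurvey, §3 Theorem (proof)] -/
theorem single_sub_single_ne_zero (hΦ : IsCMTypeWith ρ (Φ i₀)) (x : E i₀) :
    (Pi.single x (1 : ℚ) - Pi.single (ρ • x) 1 : E i₀ → ℚ) ≠ 0 := by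
  intro h0
  have h1 := congrFun h0 x
  rw [Pi.sub_apply, Pi.single_eq_same, Pi.single_eq_of_ne (hΦ.rho_smul_ne x).symm, Pi.zero_apply] at h1
  norm_num at h1

section Rank

variable [Fintype I]

/-- `Σ_i c_i = c_{i₀} + c_{i₁}` on the two-slot index type. [cite: Gordon1999HodgeAVSurvey, §3 Theorem (proof)] -/
theorem sum_eq_add_of_two {M : Type*} [AddCommMonoid M] (h01 : i₀ ≠ i₁) (hI : ∀ k, k = i₀ ∨ k = i₁)
    (c : I → M) : ∑ i, c i = c i₀ + c i₁ :=
  Fintype.sum_eq_add i₀ i₁ h01 fun k hk => by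
    rcases hI k with rfl | rfl
    · exact absurd rfl hk.1
    · exact absurd rfl hk.2

/-- The two-slot index type has two elements. [cite: Gordon1999HodgeAVSurvey, §3 Theorem (proof)] -/
theorem card_eq_two (h01 : i₀ ≠ i₁) (hI : ∀ k, k = i₀ ∨ k = i₁) : Fintype.card I = 2 := by
  have h := sum_eq_add_of_two h01 hI (fun _ => (1 : ℕ))
  simpa using h

/-! ### §2 Additivity off the Hamming balls -/

/-- **Additivity.**  Unless the three face sums `S_{x₁}, S_{x₂}, S_{x₃}` of `u_1(Ψ)` coincide and are non-zero,
EVERY slot extension `ext_i U(Φ_i)` lies in `U(Σ)` — so `U(Σ) = U(Φ₀) ⊕ U(Ψ)`.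
[cite: Gordon1999HodgeAVSurvey, §3 Theorem (proof)] [cite: Dodson1984, §5.1.2] -/
theorem forall_map_slotExt_le_of_faceSums [MulAction.IsPretransitive G (E i₀)] (h : ∀ i, IsCMTypeWith ρ (Φ i))
    (h01 : i₀ ≠ i₁) (hI : ∀ k, k = i₀ ∨ k = i₁)
    (hT : ∀ (g : G) (y : E i₁) (x : E i₀), x ∈ T (g • y) ↔ g⁻¹ • x ∈ T y) (hTi : Function.Injective T)
    (hT₀ : T y₀ = Φ i₀) (hY : ∀ y : E i₁, ∃ g : G, g • y₀ = y) (hx : Φ i₀ = {x₁, x₂, x₃}) (h12 : x₁ ≠ x₂)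
    (h13 : x₁ ≠ x₃) (h23 : x₂ ≠ x₃)
    (hφ₁ : φ₁ • x₁ = ρ • x₁ ∧ ∀ z : E i₀, z ≠ x₁ → z ≠ ρ • x₁ → φ₁ • z = z)
    (hφ₂ : φ₂ • x₂ = ρ • x₂ ∧ ∀ z : E i₀, z ≠ x₂ → z ≠ ρ • x₂ → φ₂ • z = z)
    (hφ₃ : φ₃ • x₃ = ρ • x₃ ∧ ∀ z : E i₀, z ≠ x₃ → z ≠ ρ • x₃ → φ₃ • z = z)
    (hS : (∑ y ∈ Finset.univ.filter (fun y => x₁ ∈ T y), antiVec (Φ i₁) (1 : G) y) =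
        ∑ y ∈ Finset.univ.filter (fun y => x₂ ∈ T y), antiVec (Φ i₁) (1 : G) y →
      (∑ y ∈ Finset.univ.filter (fun y => x₂ ∈ T y), antiVec (Φ i₁) (1 : G) y) =
        ∑ y ∈ Finset.univ.filter (fun y => x₃ ∈ T y), antiVec (Φ i₁) (1 : G) y →
      (∑ y ∈ Finset.univ.filter (fun y => x₁ ∈ T y), antiVec (Φ i₁) (1 : G) y) = 0) :
    ∀ i, (antiSpan G (Φ i)).map (slotExt i) ≤ antiSpan G (sigmaType Φ) := by
  obtain ⟨m₁, m₂, m₃⟩ := mem_of_eq_triple hx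
  set U := antiSpan G (sigmaType Φ) with hU
  set S₁ := ∑ y ∈ Finset.univ.filter (fun y => x₁ ∈ T y), antiVec (Φ i₁) (1 : G) y with hS₁
  set S₂ := ∑ y ∈ Finset.univ.filter (fun y => x₂ ∈ T y), antiVec (Φ i₁) (1 : G) y with hS₂
  set S₃ := ∑ y ∈ Finset.univ.filter (fun y => x₃ ∈ T y), antiVec (Φ i₁) (1 : G) y with hS₃
  -- the three explicit elements
  have q₁ := slotExt_single_add_smul_mem_antiSpan h h01 hI hT hTi hT₀ hY hx h12 h13 h23 hφ₁ hφ₂ hφ₃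
  have hx₂ : Φ i₀ = {x₂, x₁, x₃} := by rw [hx, Set.insert_comm]
  have q₂ := slotExt_single_add_smul_mem_antiSpan h h01 hI hT hTi hT₀ hY hx₂ h12.symm h23 h13 hφ₂ hφ₁ hφ₃
  have hx₃ : Φ i₀ = {x₃, x₂, x₁} := by
    rw [hx, Set.insert_comm x₁ x₂, Set.pair_comm x₁ x₃, Set.insert_comm x₂ x₃]
  have q₃ := slotExt_single_add_smul_mem_antiSpan h h01 hI hT hTi hT₀ hY hx₃ h23.symm h13.symm h12.symm hφ₃ hφ₂ hφ₁
  rw [← hS₁] at q₁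
  rw [← hS₂] at q₂
  rw [← hS₃] at q₃
  -- Step 1: a vector `δ_x − δ_{ρx}` supported on `Z` inside `U(Σ)`
  have elim : ∀ {x : E i₀} {c c' : ℚ}, c ≠ c' →
      slotExt i₀ (Pi.single x (1 : ℚ) - Pi.single (ρ • x) 1) +
        c • slotExt i₁ (fun y => if x ∈ T y then (1 : ℚ) else -1) ∈ U →
      slotExt i₀ (Pi.single x (1 : ℚ) - Pi.single (ρ • x) 1) +
        c' • slotExt i₁ (fun y => if x ∈ T y then (1 : ℚ) else -1) ∈ U →
      slotExt i₀ (Pi.single x (1 : ℚ) - Pi.single (ρ • x) 1) ∈ U := by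
    intro x c c' hcc' hc hc'
    have hne : c' - c ≠ 0 := sub_ne_zero.2 (Ne.symm hcc')
    have heq : slotExt i₀ (Pi.single x (1 : ℚ) - Pi.single (ρ • x) 1) =
        (c' - c)⁻¹ • (c' • (slotExt i₀ (Pi.single x (1 : ℚ) - Pi.single (ρ • x) 1) +
          c • slotExt i₁ (fun y => if x ∈ T y then (1 : ℚ) else -1)) -
          c • (slotExt i₀ (Pi.single x (1 : ℚ) - Pi.single (ρ • x) 1) +
          c' • slotExt i₁ (fun y => if x ∈ T y then (1 : ℚ) else -1))) := by
      rw [smul_add, smul_add, smul_smul, smul_smul, mul_comm c' c, add_sub_add_right_eq_sub, ← sub_smul, smul_smul,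
        inv_mul_cancel₀ hne, one_smul]
    rw [heq]
    exact U.smul_mem _ (U.sub_mem (U.smul_mem _ hc) (U.smul_mem _ hc'))
  have key : ∃ x : E i₀, slotExt i₀ (Pi.single x (1 : ℚ) - Pi.single (ρ • x) 1) ∈ U := by
    by_cases h₁₂ : S₁ = S₂
    · by_cases h₂₃ : S₂ = S₃
      · have h0 : S₁ = 0 := hS h₁₂ h₂₃
        refine ⟨x₁, ?_⟩
        rw [h0, zero_div, zero_smul, add_zero] at q₁
        exact q₁
      · obtain ⟨g, hg⟩ := MulAction.exists_smul_eq G x₃ x₂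
        have q₂' := slotExt_single_add_smul_mem_antiSpan_of_smul_eq h hT q₂ hg
        exact ⟨x₃, elim (fun h' => h₂₃ (by linarith)) q₂' q₃⟩
    · obtain ⟨g, hg⟩ := MulAction.exists_smul_eq G x₂ x₁
      have q₁' := slotExt_single_add_smul_mem_antiSpan_of_smul_eq h hT q₁ hg
      exact ⟨x₂, elim (fun h' => h₁₂ (by linarith)) q₁' q₂⟩
  -- Step 2: all of `Anti(Z) ⊕ 0` (pair-flip irreducibility)
  obtain ⟨x, hxU⟩ := key
  set W : Submodule ℚ (E i₀ → ℚ) := U.comap (slotExt i₀) ⊓ antiWeights ρ with hW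
  have hWeq : W = antiWeights (E := E i₀) ρ := by
    refine eq_antiWeights_of_stable_of_pairFlip (h i₀).invol (h i₀).comm (h i₀).rho_smul_ne
      (forall_exists_pairFlip_of_triple (h i₀) hx hφ₁ hφ₂ hφ₃) inf_le_right ?_ ?_
    · rw [Submodule.ne_bot_iff]
      exact ⟨_, ⟨hxU, single_sub_single_mem_antiWeights (h i₀).invol x⟩, single_sub_single_ne_zero (h i₀) x⟩
    · intro k f hf
      refine ⟨?_, fun z => ?_⟩
      · change slotExt i₀ (fun z => f (k • z)) ∈ U
        rw [← comp_smul_slotExt]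
        exact comp_smul_mem_antiSpan hf.1 k
      · have hf2 := (mem_antiWeights_iff'.1 hf.2) (k • z)
        change f (k • ρ • z) = -f (k • z)
        rw [(h i₀).comm, hf2]
  have h0 : (antiSpan G (Φ i₀)).map (slotExt i₀) ≤ U := by
    rintro _ ⟨f, hf, rfl⟩
    have hfW : f ∈ W := by rw [hWeq]; exact antiSpan_le_antiWeights' (h i₀) hf
    exact hfW.1
  -- Step 3: the slot `i₁`
  have h1 : (antiSpan G (Φ i₁)).map (slotExt i₁) ≤ U := by
    rw [antiSpan, Submodule.map_span_le]
    rintro _ ⟨g, rfl⟩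
    have hsum : antiVec (sigmaType Φ) g = slotExt i₀ (antiVec (Φ i₀) g) + slotExt i₁ (antiVec (Φ i₁) g) := by
      rw [antiVec_sigmaType_eq_sigmaLift, sigmaLift_eq_sum_slotExt]
      exact sum_eq_add_of_two h01 hI _
    have heq : slotExt i₁ (antiVec (Φ i₁) g) = antiVec (sigmaType Φ) g - slotExt i₀ (antiVec (Φ i₀) g) := by
      rw [hsum, add_sub_cancel_left]
    rw [heq]
    exact U.sub_mem (Submodule.subset_span ⟨g, rfl⟩) (h0 ⟨antiVec (Φ i₀) g, Submodule.subset_span ⟨g, rfl⟩, rfl⟩)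
  intro i
  rcases hI i with rfl | rfl
  · exact h0
  · exact h1

variable [∀ i, Nonempty (E i)]

/-- **Rank additivity off the Hamming balls**: `rank(Σ) + 2 = rank(Φ₀) + rank(Ψ) + 1`, i.e. (as every type of the
pair-flip slot is nondegenerate) `rank(Σ) = rank(Ψ) + |Z|/2` — `Hg(T × F) = Hg(T) × Hg(F)`.
[cite: Gordon1999HodgeAVSurvey, §3 Theorem (1), 7.5] [cite: Dodson1984, §5.1.2] -/
theorem typeRank_sigmaType_eq_add_of_faceSums [MulAction.IsPretransitive G (E i₀)] (h : ∀ i, IsCMTypeWith ρ (Φ i))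
    (h01 : i₀ ≠ i₁) (hI : ∀ k, k = i₀ ∨ k = i₁)
    (hT : ∀ (g : G) (y : E i₁) (x : E i₀), x ∈ T (g • y) ↔ g⁻¹ • x ∈ T y) (hTi : Function.Injective T)
    (hT₀ : T y₀ = Φ i₀) (hY : ∀ y : E i₁, ∃ g : G, g • y₀ = y) (hx : Φ i₀ = {x₁, x₂, x₃}) (h12 : x₁ ≠ x₂)
    (h13 : x₁ ≠ x₃) (h23 : x₂ ≠ x₃)
    (hφ₁ : φ₁ • x₁ = ρ • x₁ ∧ ∀ z : E i₀, z ≠ x₁ → z ≠ ρ • x₁ → φ₁ • z = z)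
    (hφ₂ : φ₂ • x₂ = ρ • x₂ ∧ ∀ z : E i₀, z ≠ x₂ → z ≠ ρ • x₂ → φ₂ • z = z)
    (hφ₃ : φ₃ • x₃ = ρ • x₃ ∧ ∀ z : E i₀, z ≠ x₃ → z ≠ ρ • x₃ → φ₃ • z = z)
    (hS : (∑ y ∈ Finset.univ.filter (fun y => x₁ ∈ T y), antiVec (Φ i₁) (1 : G) y) =
        ∑ y ∈ Finset.univ.filter (fun y => x₂ ∈ T y), antiVec (Φ i₁) (1 : G) y →
      (∑ y ∈ Finset.univ.filter (fun y => x₂ ∈ T y), antiVec (Φ i₁) (1 : G) y) =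
        ∑ y ∈ Finset.univ.filter (fun y => x₃ ∈ T y), antiVec (Φ i₁) (1 : G) y →
      (∑ y ∈ Finset.univ.filter (fun y => x₁ ∈ T y), antiVec (Φ i₁) (1 : G) y) = 0) :
    typeRank G (sigmaType Φ) = typeRank G (Φ i₁) + Fintype.card (E i₀) / 2 := by
  haveI : Nonempty I := ⟨i₀⟩
  have hadd := typeRank_sigmaType_add_card_eq_of_forall_map_le h
    (forall_map_slotExt_le_of_faceSums h h01 hI hT hTi hT₀ hY hx h12 h13 h23 hφ₁ hφ₂ hφ₃ hS)
  rw [card_eq_two h01 hI, sum_eq_add_of_two h01 hI,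
    typeRank_eq_of_pairFlip (h i₀) (forall_exists_pairFlip_of_triple (h i₀) hx hφ₁ hφ₂ hφ₃)] at hadd
  omega

/-- **Off the Hamming balls the family is nondegenerate iff `Ψ` is.** [cite: Gordon1999HodgeAVSurvey, 7.5]
[cite: Dodson1984, §3.3.2] -/
theorem typeRank_sigmaType_eq_iff_of_faceSums [MulAction.IsPretransitive G (E i₀)] (h : ∀ i, IsCMTypeWith ρ (Φ i))
    (h01 : i₀ ≠ i₁) (hI : ∀ k, k = i₀ ∨ k = i₁)
    (hT : ∀ (g : G) (y : E i₁) (x : E i₀), x ∈ T (g • y) ↔ g⁻¹ • x ∈ T y) (hTi : Function.Injective T)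
    (hT₀ : T y₀ = Φ i₀) (hY : ∀ y : E i₁, ∃ g : G, g • y₀ = y) (hx : Φ i₀ = {x₁, x₂, x₃}) (h12 : x₁ ≠ x₂)
    (h13 : x₁ ≠ x₃) (h23 : x₂ ≠ x₃)
    (hφ₁ : φ₁ • x₁ = ρ • x₁ ∧ ∀ z : E i₀, z ≠ x₁ → z ≠ ρ • x₁ → φ₁ • z = z)
    (hφ₂ : φ₂ • x₂ = ρ • x₂ ∧ ∀ z : E i₀, z ≠ x₂ → z ≠ ρ • x₂ → φ₂ • z = z)
    (hφ₃ : φ₃ • x₃ = ρ • x₃ ∧ ∀ z : E i₀, z ≠ x₃ → z ≠ ρ • x₃ → φ₃ • z = z)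
    (hS : (∑ y ∈ Finset.univ.filter (fun y => x₁ ∈ T y), antiVec (Φ i₁) (1 : G) y) =
        ∑ y ∈ Finset.univ.filter (fun y => x₂ ∈ T y), antiVec (Φ i₁) (1 : G) y →
      (∑ y ∈ Finset.univ.filter (fun y => x₂ ∈ T y), antiVec (Φ i₁) (1 : G) y) =
        ∑ y ∈ Finset.univ.filter (fun y => x₃ ∈ T y), antiVec (Φ i₁) (1 : G) y →
      (∑ y ∈ Finset.univ.filter (fun y => x₁ ∈ T y), antiVec (Φ i₁) (1 : G) y) = 0) :
    typeRank G (sigmaType Φ) = Fintype.card (Σ k, E k) / 2 + 1 ↔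
      typeRank G (Φ i₁) = Fintype.card (E i₁) / 2 + 1 := by
  haveI : Nonempty I := ⟨i₀⟩
  rw [typeRank_sigmaType_eq_iff_forall_of_forall_map_le h
    (forall_map_slotExt_le_of_faceSums h h01 hI hT hTi hT₀ hY hx h12 h13 h23 hφ₁ hφ₂ hφ₃ hS)]
  have h0 := typeRank_eq_of_pairFlip (h i₀) (forall_exists_pairFlip_of_triple (h i₀) hx hφ₁ hφ₂ hφ₃)
  constructor
  · exact fun hall => hall i₁
  · intro h1 i
    rcases hI i with rfl | rfl
    · exact h0
    · exact h1

end Rank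

end ReflexSlot

end Literature.NumberTheory.ComplexMultiplication

end
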